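import Literature.NumberTheory.GaloisRepresentations.ArtinLFunctionProofs
import Literature.NumberTheory.GaloisRepresentations.GaloisRep
import HarnessLib

/-!
# The completed Artin L-function of an odd two-dimensional representation of `ℚ`
(Deligne–Serre 1974, proof of Thm. 4.6, step (ii))

In the proof of Thm. 4.6 of *Formes modulaires de poids 1* (Ann. Sci. ÉNS (4) 7 (1974),
p. 515), step (ii) reads: "D'après 4.5, le « facteur à l'infini » de `L(s, ρ)` est égal à
`(2π)^{-s} Γ(s)`.  Si `M` est le conducteur de `ρ`, et si l'on pose
`ζ(s, ρ) = M^{s/2} (2π)^{-s} Γ(s) L(s, ρ)`, on a donc `ζ(1 - s, ρ) = v · ζ(s, ρ̄)` avec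
`v ∈ ℂ*`."  The functional equation itself is Artin's (in the tree: the named fact
`Literature.NumberTheory.Automorphic.artin_functional_equation`, for the completed L-function
`Λ(ρ, s) = A(ρ)^{s/2} γ(ρ, s) L(ρ, s)` of `Literature.NumberTheory.GaloisRepresentations.ArtinLFunction`).
This file **proves** the two identifications that turn the tree's `Λ(ρ, s)` into
Deligne–Serre's `ζ(s, ρ)` for an *odd* two-dimensional Artin representation `ρ` of `ℚ`:

* `Literature.NumberTheory.GaloisRepresentations.ArtinRep.artinConductorNorm_eq_artinConductorNat` — over `ℚ`,
  `A(ρ) = |d_ℚ|^{dim V} N 𝔣(ρ) = N 𝔣(ρ) = M` (`d_ℚ = 1`, Mathlib `Rat.numberField_discr`);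
* `Literature.NumberTheory.GaloisRepresentations.FramedArtinRep.signature_eq_of_isOdd` — the signature of an odd `ρ : Γ_ℚ → GL₂(ℂ)` at
  the real place is `(1, 1)` (Rem. 4.5: `ρ(c)` is conjugate to `diag(1, -1)`), via the
  linear-algebra lemma `finrank_eigenspace_eq_one_of_mul_self_eq_one_of_det_eq_neg_one`
  (an involution of `ℂ²` of determinant `-1` has one-dimensional `±1`-eigenspaces);
* hence `Literature.NumberTheory.GaloisRepresentations.FramedArtinRep.gammaFactor_eq_of_isOdd`:
  `γ(ρ, s) = Γ_ℝ(s) Γ_ℝ(s + 1) = Γ_ℂ(s) = 2 (2π)^{-s} Γ(s)` (Legendre duplication, Mathlib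
  `Complex.Gammaℝ_mul_Gammaℝ_add_one`), and
  `Literature.NumberTheory.GaloisRepresentations.FramedArtinRep.completedArtinLFunction_eq_of_isOdd`:
  `Λ(ρ, s) = 2 · M^{s/2} (2π)^{-s} Γ(s) L(ρ, s) = 2 ζ(s, ρ)`.

Everything here is proved (no named facts); it is a leaf of the decomposition of
`Literature.NumberTheory.Automorphic.artinConductorNat_eq_level` (fact-owner's NOTES; top layer
`Literature.NumberTheory.Automorphic.LanglandsTunnellProofs`).

## References

* P. Deligne, J.-P. Serre, *Formes modulaires de poids 1*, Ann. Sci. ÉNS (4) 7 (1974),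
  Rem. 4.5 and §4 (b), proof of Thm. 4.6, step (ii) (`DeligneSerreASENS1974`).
* J. Martinet, *Character theory and Artin L-functions* (Durham 1975), Academic Press 1977,
  §3 (archimedean factors `Γ_ℝ(s)^{n⁺} Γ_ℝ(s+1)^{n⁻}`) (`MartinetDurham1977`).
-/

noncomputable section

open scoped NumberField
open Module NumberField Complex

namespace Literature.NumberTheory.GaloisRepresentations

/-! ### Over `ℚ` the constant `A(ρ)` is the numerical Artin conductor -/

section RatConductor

variable {V : Type*} [AddCommGroup V] [Module ℂ V] [TopologicalSpace V]

/-- Over `ℚ` the constant of the functional equation is the numerical Artin conductor: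
`A(ρ) = |d_ℚ|^{dim V} · N 𝔣(ρ) = N 𝔣(ρ)` since `d_ℚ = 1` (Mathlib `Rat.numberField_discr`).
Ref: Deligne–Serre 1974, §4 (b) (ii) ("si `M` est le conducteur de `ρ` …
`ζ(s, ρ) = M^{s/2} (2π)^{-s} Γ(s) L(s, ρ)`"). [folklore] -/
theorem ArtinRep.artinConductorNorm_eq_artinConductorNat (ρ : ArtinRep ℚ V) :
    ρ.artinConductorNorm = GaloisRep.artinConductorNat ρ := by
  rw [ArtinRep.artinConductorNorm, Rat.numberField_discr, Int.natAbs_one, one_pow, one_mul]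

end RatConductor

/-! ### The signature of an odd two-dimensional representation is `(1, 1)` -/

section OddSignature

/-- **Eigenvalues of an odd involution of `ℂ²`.**  If `T` is an endomorphism of a
two-dimensional complex vector space with `T * T = 1` and `det T = -1`, then its `+1`- and
`-1`-eigenspaces are both lines: they meet in `0`, so their dimensions add up to at most `2`,
and neither is `0`, since `V^{T=-1} = 0` (resp. `V^{T=1} = 0`) makes `T + 1` (resp. `T - 1`)
injective, hence bijective, and then `(T - 1)(T + 1) = 0` forces `T = 1` (resp. `T = -1`),
of determinant `1 ≠ -1`.
Ref: Deligne–Serre 1974, Rem. 4.5 ("comme `c` est d'ordre 2, cela signifie que `ρ(c)` est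
conjuguée de la matrice `(1 0; 0 -1)`"). [folklore] -/
theorem finrank_eigenspace_eq_one_of_mul_self_eq_one_of_det_eq_neg_one {M : Type*}
    [AddCommGroup M] [Module ℂ M] [FiniteDimensional ℂ M] (h2 : finrank ℂ M = 2)
    {T : Module.End ℂ M} (hT : T * T = 1) (hdet : LinearMap.det T = -1) :
    finrank ℂ (T.eigenspace 1) = 1 ∧ finrank ℂ (T.eigenspace (-1)) = 1 := by
  have hTT : ∀ x, T (T x) = x := fun x => by
    rw [← Module.End.mul_apply, hT, Module.End.one_apply]
  -- the two eigenspaces meet in `0`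
  have hinf : T.eigenspace 1 ⊓ T.eigenspace (-1) = ⊥ := by
    rw [eq_bot_iff]
    intro x hx
    obtain ⟨h₁, h₂⟩ := Submodule.mem_inf.mp hx
    rw [Module.End.mem_eigenspace_iff, one_smul] at h₁
    rw [Module.End.mem_eigenspace_iff, neg_one_smul] at h₂
    have h2x : (2 : ℂ) • x = 0 := by
      rw [two_smul]
      nth_rw 2 [← h₁]
      rw [h₂, add_neg_cancel]
    exact (Submodule.mem_bot ℂ).mpr ((smul_eq_zero.mp h2x).resolve_left two_ne_zero)
  have hle : finrank ℂ (T.eigenspace 1) + finrank ℂ (T.eigenspace (-1)) ≤ 2 := by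
    have h := Submodule.finrank_sup_add_finrank_inf_eq (T.eigenspace 1) (T.eigenspace (-1))
    rw [hinf, finrank_bot, add_zero] at h
    rw [← h, ← h2]
    exact Submodule.finrank_le _
  -- `V^{T = -1} ≠ 0`
  have hne1 : T.eigenspace (-1) ≠ ⊥ := by
    intro hbot
    have hinj : Function.Injective ⇑(T + (1 : Module.End ℂ M)) := by
      rw [← LinearMap.ker_eq_bot, eq_bot_iff]
      intro x hx
      rw [LinearMap.mem_ker, LinearMap.add_apply, Module.End.one_apply, add_eq_zero_iff_eq_neg] at hx
      have : x ∈ T.eigenspace (-1) := by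
        rw [Module.End.mem_eigenspace_iff, neg_one_smul]
        exact hx
      rw [hbot] at this
      exact this
    have hsurj := LinearMap.injective_iff_surjective.mp hinj
    have hT1 : T = 1 := by
      refine LinearMap.ext fun y => ?_
      obtain ⟨x, rfl⟩ := hsurj y
      rw [LinearMap.add_apply, Module.End.one_apply, map_add, hTT, Module.End.one_apply, add_comm]
    rw [hT1, map_one] at hdet
    norm_num at hdet
  -- `V^{T = 1} ≠ 0`
  have hne2 : T.eigenspace 1 ≠ ⊥ := by
    intro hbot
    have hinj : Function.Injective ⇑(T - (1 : Module.End ℂ M)) := by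
      rw [← LinearMap.ker_eq_bot, eq_bot_iff]
      intro x hx
      rw [LinearMap.mem_ker, LinearMap.sub_apply, Module.End.one_apply, sub_eq_zero] at hx
      have : x ∈ T.eigenspace 1 := by
        rw [Module.End.mem_eigenspace_iff, one_smul]
        exact hx
      rw [hbot] at this
      exact this
    have hsurj := LinearMap.injective_iff_surjective.mp hinj
    have hT1 : T = (-1 : ℂ) • (1 : Module.End ℂ M) := by
      refine LinearMap.ext fun y => ?_
      obtain ⟨x, rfl⟩ := hsurj y
      rw [LinearMap.sub_apply, Module.End.one_apply, map_sub, hTT, LinearMap.smul_apply,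
        Module.End.one_apply, neg_one_smul, neg_sub]
    rw [hT1, LinearMap.det_smul, map_one, h2] at hdet
    norm_num at hdet
  have h1 : 0 < finrank ℂ (T.eigenspace 1) := Nat.pos_of_ne_zero fun h =>
    hne2 (Submodule.finrank_eq_zero.mp h)
  have h2' : 0 < finrank ℂ (T.eigenspace (-1)) := Nat.pos_of_ne_zero fun h =>
    hne1 (Submodule.finrank_eq_zero.mp h)
  omega

variable (ρ : FramedArtinRep ℚ 2)

/-- The linear map `ρ(σ)` on column vectors is `Matrix.toLin'` of the matrix `ρ σ`, so its
determinant is `det (ρ σ)`. [folklore] -/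
theorem FramedArtinRep.det_toArtinRep_apply (σ : Field.absoluteGaloisGroup ℚ) :
    LinearMap.det ((ρ.toArtinRep σ : (Fin 2 → ℂ) →ₗ[ℂ] (Fin 2 → ℂ))) =
      ((ρ σ : GL (Fin 2) ℂ) : Matrix (Fin 2) (Fin 2) ℂ).det := by
  have : (ρ.toArtinRep σ : (Fin 2 → ℂ) →ₗ[ℂ] (Fin 2 → ℂ)) =
      Matrix.toLin' ((ρ σ : GL (Fin 2) ℂ) : Matrix (Fin 2) (Fin 2) ℂ) := by
    refine LinearMap.ext fun v => ?_
    simp only [Matrix.toLin'_apply, FramedRep.toContinuousRep_apply_apply]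
  rw [this, LinearMap.det_toLin']

/-- **The signature of an odd two-dimensional Artin representation of `ℚ` is `(1, 1)`.**  For
`ρ : Γ_ℚ → GL₂(ℂ)` odd (`det ρ(c) = -1` for every complex conjugation `c`) and the (unique) real
embedding `φ` of `ℚ`, the `±1`-eigenspaces of `ρ(c)` are lines: `c² = 1`
(`IsComplexConjugation.sq_eq_one`) and `det ρ(c) = -1`.
Ref: Deligne–Serre 1974, Rem. 4.5 (`ρ(c)` is conjugate to `diag(1, -1)`); Martinet,
*Character theory and Artin L-functions* (1977), §3. [folklore] -/
theorem FramedArtinRep.signature_eq_of_isOdd (hodd : FramedGaloisRep.IsOdd ρ) (φ : ℚ →+* ℝ) :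
    ρ.toArtinRep.signature φ = (1, 1) := by
  obtain ⟨c, hc⟩ := exists_isComplexConjugation φ
  rw [ArtinRep.signature_eq_holds ρ.toArtinRep hc]
  have hT : (ρ.toArtinRep c : (Fin 2 → ℂ) →ₗ[ℂ] (Fin 2 → ℂ)) * ρ.toArtinRep c = 1 := by
    rw [← map_mul, ← pow_two, hc.sq_eq_one, map_one]
  have hdet : LinearMap.det (ρ.toArtinRep c : (Fin 2 → ℂ) →ₗ[ℂ] (Fin 2 → ℂ)) = -1 := by
    rw [FramedArtinRep.det_toArtinRep_apply]
    have h := hodd φ c hc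
    have h' := congrArg (fun u : ℂˣ => (u : ℂ)) h
    simpa [Matrix.GeneralLinearGroup.val_det_apply] using h'
  obtain ⟨h1, h2⟩ := finrank_eigenspace_eq_one_of_mul_self_eq_one_of_det_eq_neg_one
    (Module.finrank_fin_fun ℂ) hT hdet
  exact Prod.ext h1 h2

/-- **Deligne–Serre 1974, §4 (b) (ii): the factor at infinity of an odd `ρ`.**  For an odd
two-dimensional Artin representation of `ℚ` the archimedean `Γ`-factor is
`γ(ρ, s) = Γ_ℝ(s) Γ_ℝ(s + 1) = Γ_ℂ(s) = 2 (2π)^{-s} Γ(s)` ("D'après 4.5, le facteur à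
l'infini de `L(s, ρ)` est égal à `(2π)^{-s} Γ(s)`", up to the harmless constant `2` of
Mathlib's normalisation `Complex.Gammaℂ`).
Ref: Deligne–Serre 1974, p. 515 (ii); Martinet (1977), §3. [cite: DeligneSerreASENS1974, §4 (b) proof of Thm. 4.6 (ii)] -/
theorem FramedArtinRep.gammaFactor_eq_of_isOdd (hodd : FramedGaloisRep.IsOdd ρ) (s : ℂ) :
    ρ.toArtinRep.gammaFactor s = Complex.Gammaℂ s := by
  rw [ArtinRep.gammaFactor, Fintype.prod_subsingleton _ Rat.infinitePlace,
    dif_pos Rat.isReal_infinitePlace, ρ.signature_eq_of_isOdd hodd, pow_one, pow_one,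
    Complex.Gammaℝ_mul_Gammaℝ_add_one]

/-- **Deligne–Serre 1974, §4 (b) (ii): the completed L-function of an odd `ρ`.**  For an odd
two-dimensional Artin representation `ρ` of `ℚ` with numerical Artin conductor
`M = artinConductorNat ρ`, the completed Artin L-function of the tree is
`Λ(ρ, s) = M^{s/2} Γ_ℂ(s) L(ρ, s) = 2 · ζ(s, ρ)` with Deligne–Serre's
`ζ(s, ρ) = M^{s/2} (2π)^{-s} Γ(s) L(s, ρ)`.
Ref: Deligne–Serre 1974, p. 515 (ii). [cite: DeligneSerreASENS1974, §4 (b) proof of Thm. 4.6 (ii)] -/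
theorem FramedArtinRep.completedArtinLFunction_eq_of_isOdd (hodd : FramedGaloisRep.IsOdd ρ)
    (s : ℂ) :
    completedArtinLFunction ρ.toArtinRep s =
      2 * ((GaloisRep.artinConductorNat ρ.toGaloisRep : ℂ) ^ (s / 2) *
        (2 * Real.pi : ℂ) ^ (-s) * Complex.Gamma s * artinLFunction ρ.toArtinRep s) := by
  rw [completedArtinLFunction, ρ.gammaFactor_eq_of_isOdd hodd, Complex.Gammaℂ_def,
    ArtinRep.artinConductorNorm_eq_artinConductorNat]
  ring

end OddSignature

end Literature.NumberTheory.GaloisRepresentations
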